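import Summits.KontsevichZagierPeriods.KontsevichZagierPeriods.Theses.TorsionLogs
import Summits.KontsevichZagierPeriods.KontsevichZagierPeriods.Theorems.TorsionLogsNeronTorsionSector
import Literature.NumberTheory.Transcendental.KZKernelConjectureForms

/-!
# Crux `TorsionSectorComplete` (stmt-KontsevichZagierPeriods-14212) — line `NeronTorsionOval`
# (forward generator G1 `next-rung` over the floor `NeronTorsionPrimitiveChain`, unit fwd2-rung-KontsevichZagierPeriods-01, gen 4)

Route `TorsionLogs` (route-KontsevichZagierPeriods-TorsionLogs; `closes (h₁ : NeronTorsionSector)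
(h₂ : TorsionSectorComplete) : KontsevichZagierPeriods`; `h₁` CLOSED by the landed translation chain
`NeronTorsionSector_of = NeronTorsionSector_of_primitiveChain stub_assembly`, `h₂` the open residual).

## The rung: the real OVAL component

The floor `stub_assembly : NeronTorsionPrimitiveChain` (seed g1-KontsevichZagierPeriods-17981) treats a real
`N`-torsion point `P` on the IDENTITY component `x > e₁` (`e₁` the largest real root, base corner `T₁ = (e₁, 0)`,
regime `0 < e₁`).  When the discriminant is positive the real curve has a second component, the oval
`e₃ ≤ x ≤ e₂` (`e₃ < e₂ < e₁` the three real roots, `e₁ = -e₂-e₃ > 0` automatically), and the floor says nothing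
about torsion points on it.  Both sibling forward lines (`NeronTorsionTwoPoint`, `shifted_eta_sector`) list the
oval as `gap_after` ("ω₂, η₂ enter").  They do NOT enter: with `Λ(u) = -log|σ(u)| + Re(u η(u))/2`
(real-analytic, `Λ`-periodic, `Λ(nu) = n² Λ(u) - log|ψₙ(u)|`), on the oval `u = ω₂/2 + v` the constant
`Re(ω₂ η₂)/8` is common to `P` and to the base corner `T₃ = (e₃, 0)` and cancels:

  `II₃(P) + (a/N)² · η₁ω₁/2 = log|ψ_{N-1}(P)|/(N²-2N) - log|ψ₃(e₃)|/8 ∈ ℚ · log(ℚ̄ ∩ ℝ)_{>0}`,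

`II₃(P) = ∫∫_{e₃<x'<x<x_P} x' dx' dx/(√f(x') √f(x))`, `v_P = ∫_{e₃}^{x_P} dx/√f = (a/N) ω₁`,
`η₁ω₁/2 = (∫_{e₃}^{e₂} dx/√f)(∫_{e₃}^{e₂} (-2x) dx/√f)` (checked to 3·10⁻¹¹ on 10 curves/points, folder
`compute/egg_check.py`).  THE ONE NEW MOVE that proves it inside KZ's three rules: translation by the 2-torsion point
`T₂ = (e₂, 0)` is the Möbius map `φ₂(x) = e₂ + (e₂-e₁)(e₂-e₃)/(x-e₂)`, an increasing bijection `(e₃, e₂) → (e₁, ∞)`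
defined over `ℚ(e₁,e₂,e₃) ⊂ ℚ̄` with `dx/√f(x) ↦ dt/√f(t)` (rule 2), carrying `T₃ ↦ T₁`, `P ↦ P + T₂` (a real
torsion point on the identity component with `(2N) · u(P+T₂) = (N-2a) · ω₁`), the oval triangle onto the FLOOR's
triangle at `P + T₂` up to the exact form `φ₂(t') dt'/y - t' dt'/y = -d(y/(2(t'-e₂)))` (rule 3), whose boundary term
is `-log C`, `C = √((e₂-e₃)/(e₂-x_P)) ∈ ℚ̄`, and the oval-native carrier onto the floor's carrier (rule 2 in each
variable + one Stokes step).  So:  OVAL CHAIN = TRANSPORT (stub 1, new) + FLOOR CHAIN at `P + T₂` (stub 2 = the seed's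
statement with its unused `addOrderOf` hypothesis deleted — `addOrderOf (P + T₂) ∈ {N', N'/2}` is not derivable
from the analytic torsion relation without the analytic↔algebraic order dictionary the floor never needed).

RUNG `NeronTorsionRealComponents := ∀ onOval : Bool, NeronTorsionComponentSector onOval`, member `false` =
`Theses.TorsionLogs.NeronTorsionSector` VERBATIM (the floor's tied sector; F3 witness `neronTorsionComponentSector_false`
names the seed), member `true` = the tied oval sector (tie `N² k = M a²`, i.e. `k/M = (arc(base → P)/ω₁)²` in both
members).  F4: the summit implies the rung in five lines (`neronTorsionRealComponents_of_kontsevichZagierPeriods`).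
RESIDUAL (stub 3) = completeness of the moves relative to `relations ⊔ closure (T ∪ T^{oval})` — strictly weaker than
the crux as typed (`realComponentsComplete_of_torsionSectorComplete`), conjecture-grade, declared residual.

Stubs (registered): `stub_ovalTransport` (M–L, the content), `stub_identityChainFree` (M, the floor's proof verbatim
with `_hord` dropped), `stub_realComponentsComplete` (residual).  Sorry-free: `ovalPrimitiveChain_of`,
`ovalSector_of_ovalChain` (the landed bookkeeping of `NeronTorsionSector_of_primitiveChain` with the reduced fraction
`a/N = p/q` and the tie `N² k = M a²`), `neronTorsionRealComponents_of` (= `Rung_of`), `closure_ovalTied_le_relations`,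
`neronTorsionComponentSector_false` (F3), `neronTorsionRealComponents_of_kontsevichZagierPeriods` (F4),
`realComponentsComplete_of_torsionSectorComplete`, `TorsionSectorComplete_of` (the crux BY NAME).
[cite: KontsevichZagier2001, §1.1–1.2] [cite: Lang1983, Ch. 13 Thm 1.1] [cite: Silverman2009, III.2.3, VI.3]
-/

noncomputable section

open Set MeasureTheory Filter Topology
open Literature.NumberTheory.Transcendental Literature.ModelTheory.ExponentialFields
open Summit.KontsevichZagierPeriods.KontsevichZagierPeriods.Theses.TorsionLogs (NeronTorsionSector TorsionSectorComplete)
open Summit.KontsevichZagierPeriods.HyperbolicBloch.OffTetraSectorKernel (exists_logRep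
  interval_log_relation_mem_relations hermiteLindemann_evalP_log)
open Summit.KontsevichZagierPeriods.KontsevichZagierPeriods.Cruxes.NeronTorsionSector.Translation (logRep_value
  isAlgebraic_of_logRep NeronTorsionSector_of_primitiveChain stub_assembly NeronTorsionSector_of
  exists_carrier_of_logFamily)

-- `Summit.KontsevichZagierPeriods.KontsevichZagierPeriods.…` is the tree's mandated layout (single-conjunct summit).
set_option linter.dupNamespace false

namespace Summit.KontsevichZagierPeriods.KontsevichZagierPeriods.Cruxes.TorsionSectorComplete.NeronTorsionOval

/-! ### The rung family (indexed by the real component carrying the torsion point) -/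

/-- The tied Néron–torsion sector on either real component.  `false`: the IDENTITY component —
`Theses.TorsionLogs.NeronTorsionSector` verbatim (base corner `T₁ = (e₁,0)`, `e₁` the largest root, `0 < e₁`,
tie `4N²k = M(N-2a)²`).  `true`: the OVAL `e₃ < x < e₂` (`e₃ < e₂` the two smaller roots, `f > 0` between them,
base corner `T₃ = (e₃,0)`, arc relation `N · ∫_{e₃}^{x_P} dx/√f = a · (2∫_{e₃}^{e₂} dx/√f)`, oval-native carrier
`[(e₃,e₂)², (√f(x))⁻¹ · (-2x')/√f(x')]` of value `η₁ω₁/2`, tie `N²k = Ma²`).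
[cite: KontsevichZagier2001, §1.2] [cite: Silverman2009, VI.3] -/
def NeronTorsionComponentSector : Bool → Prop
  | false => ∀ (g₂ g₃ e₁ xP yP α : ℝ) (N a : ℕ) (M k m : ℤ) (f : ℝ → ℝ), (∀ x, f x = 4 * x ^ 3 - g₂ * x - g₃) → g₂ ^ 3 - 27 * g₃ ^ 2 ≠ 0 → f e₁ = 0 → 0 < e₁ → (∀ x, e₁ < x → 0 < f x) → e₁ < xP → yP ^ 2 = f xP → 3 ≤ N → 0 < a → 2 * a < N → 4 * (N : ℤ) ^ 2 * k = M * ((N : ℤ) - 2 * (a : ℤ)) ^ 2 → (∀ hns : (⟨0, 0, 0, -g₂ / 4, -g₃ / 4⟩ : WeierstrassCurve ℝ).toAffine.Nonsingular xP (yP / 2), addOrderOf (WeierstrassCurve.Affine.Point.some xP (yP / 2) hns) = N) → (N : ℝ) * (∫ x in Set.Ioi xP, (Real.sqrt (f x))⁻¹) = a * (2 * ∫ x in Set.Ioi e₁, (Real.sqrt (f x))⁻¹) → 1 < α → ∀ (rI rP : Literature.NumberTheory.Transcendental.KZ.IntegralRep 2) (rL : Literature.NumberTheory.Transcendental.KZ.IntegralRep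 1), rI.domain = {z | e₁ < z 1 ∧ z 1 < z 0 ∧ z 0 < xP} → Set.EqOn rI.integrand (fun z => z 1 / (Real.sqrt (f (z 1)) * Real.sqrt (f (z 0)))) rI.domain → rP.domain = {z | e₁ < z 0 ∧ e₁ < z 1} → Set.EqOn rP.integrand (fun z => (Real.sqrt (f (z 0)))⁻¹ * ((g₂ * z 1 + 2 * g₃) / (2 * (z 1) ^ 2 * Real.sqrt (f (z 1))))) rP.domain → rL.domain = {t | 1 < t 0 ∧ t 0 < α} → Set.EqOn rL.integrand (fun t => (t 0)⁻¹) rL.domain → (M : ℝ) * rI.value + k * rP.value = m * rL.value → M • Literature.NumberTheory.Transcendental.KZ.of rI + k • Literature.NumberTheory.Transcendental.KZ.of rP - m • Literature.NumberTheory.Transcendental.KZ.of rL ∈ Literature.NumberTheory.Transcendental.KZ.relations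
  | true => ∀ (g₂ g₃ e₂ e₃ xP yP α : ℝ) (N a : ℕ) (M k m : ℤ) (f : ℝ → ℝ), (∀ x, f x = 4 * x ^ 3 - g₂ * x - g₃) → g₂ ^ 3 - 27 * g₃ ^ 2 ≠ 0 → f e₃ = 0 → f e₂ = 0 → e₃ < e₂ → (∀ x, e₃ < x → x < e₂ → 0 < f x) → e₃ < xP → xP < e₂ → yP ^ 2 = f xP → 3 ≤ N → 0 < a → 2 * a < N → (N : ℤ) ^ 2 * k = M * (a : ℤ) ^ 2 → (∀ hns : (⟨0, 0, 0, -g₂ / 4, -g₃ / 4⟩ : WeierstrassCurve ℝ).toAffine.Nonsingular xP (yP / 2), addOrderOf (WeierstrassCurve.Affine.Point.some xP (yP / 2) hns) = N) → (N : ℝ) * (∫ x in Set.Ioo e₃ xP, (Real.sqrt (f x))⁻¹) = a * (2 * ∫ x in Set.Ioo e₃ e₂, (Real.sqrt (f x))⁻¹) → 1 < α → ∀ (rI rP : Literature.NumberTheory.Transcendental.KZ.IntegralRep 2) (rL : Literature.NumberTheory.Transcendental.KZ.IntegralRep 1), rI.domain = {z | e₃ < z 1 ∧ z 1 < z 0 ∧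 z 0 < xP} → Set.EqOn rI.integrand (fun z => z 1 / (Real.sqrt (f (z 1)) * Real.sqrt (f (z 0)))) rI.domain → rP.domain = {z | e₃ < z 0 ∧ z 0 < e₂ ∧ e₃ < z 1 ∧ z 1 < e₂} → Set.EqOn rP.integrand (fun z => (Real.sqrt (f (z 0)))⁻¹ * (-(2 * z 1) / Real.sqrt (f (z 1)))) rP.domain → rL.domain = {t | 1 < t 0 ∧ t 0 < α} → Set.EqOn rL.integrand (fun t => (t 0)⁻¹) rL.domain → (M : ℝ) * rI.value + k * rP.value = m * rL.value → M • Literature.NumberTheory.Transcendental.KZ.of rI + k • Literature.NumberTheory.Transcendental.KZ.of rP - m • Literature.NumberTheory.Transcendental.KZ.of rL ∈ Literature.NumberTheory.Transcendental.KZ.relations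

/-- **THE RUNG.** The tied Néron–torsion sector on BOTH real components of a real Weierstrass curve with three real
`2`-torsion points: every tied element `M•[rI] + k•[rP] − m•[rL]` of value `0`, built from a real torsion point on
either component, is a finite chain of KZ moves.  Member `false` is the floor's crux `NeronTorsionSector` (closed);
member `true` (the oval) is new. [cite: KontsevichZagier2001, §1.2] -/
def NeronTorsionRealComponents : Prop := ∀ onOval : Bool, NeronTorsionComponentSector onOval

/-- The primitive oval chain (the `∃`-form the stubs produce; exponents `(q², p²)` with `a/N = p/q` reduced):
`q²•[II₃(P)] + p²•[η₁ω₁/2] − c•[log B] ∈ relations`. [cite: KontsevichZagier2001, §1.2] -/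
def OvalPrimitiveChain : Prop := ∀ (g₂ g₃ e₂ e₃ xP yP : ℝ) (N a p q : ℕ) (f : ℝ → ℝ), (∀ x, f x = 4 * x ^ 3 - g₂ * x - g₃) → g₂ ^ 3 - 27 * g₃ ^ 2 ≠ 0 → f e₃ = 0 → f e₂ = 0 → e₃ < e₂ → (∀ x, e₃ < x → x < e₂ → 0 < f x) → e₃ < xP → xP < e₂ → yP ^ 2 = f xP → 3 ≤ N → 0 < a → 2 * a < N → (∀ hns : (⟨0, 0, 0, -g₂ / 4, -g₃ / 4⟩ : WeierstrassCurve ℝ).toAffine.Nonsingular xP (yP / 2), addOrderOf (WeierstrassCurve.Affine.Point.some xP (yP / 2) hns) = N) → (N : ℝ) * (∫ x in Set.Ioo e₃ xP, (Real.sqrt (f x))⁻¹) = a * (2 * ∫ x in Set.Ioo e₃ e₂, (Real.sqrt (f x))⁻¹) → Nat.Coprime p q → (q : ℤ) * (a : ℤ) = (p : ℤ) * (N : ℤ) → ∀ (rI rP : Literature.NumberTheory.Transcendental.KZ.IntegralRep 2), rI.domain = {z | e₃ < z 1 ∧ z 1 < z 0 ∧ z 0 < xP} → Set.EqOn rI.integrand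 (fun z => z 1 / (Real.sqrt (f (z 1)) * Real.sqrt (f (z 0)))) rI.domain → rP.domain = {z | e₃ < z 0 ∧ z 0 < e₂ ∧ e₃ < z 1 ∧ z 1 < e₂} → Set.EqOn rP.integrand (fun z => (Real.sqrt (f (z 0)))⁻¹ * (-(2 * z 1) / Real.sqrt (f (z 1)))) rP.domain → ∃ (c : ℤ) (B : ℝ) (rB : Literature.NumberTheory.Transcendental.KZ.IntegralRep 1), 1 < B ∧ IsAlgebraic ℚ B ∧ rB.domain = {t | 1 < t 0 ∧ t 0 < B} ∧ Set.EqOn rB.integrand (fun t => (t 0)⁻¹) rB.domain ∧ ((q : ℤ) ^ 2) • Literature.NumberTheory.Transcendental.KZ.of rI + ((p : ℤ) ^ 2) • Literature.NumberTheory.Transcendental.KZ.of rP - c • Literature.NumberTheory.Transcendental.KZ.of rB ∈ Literature.NumberTheory.Transcendental.KZ.relations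

/-! ### Stub statements -/

/-- **Stub 1 statement (the new move): transport by the 2-torsion point `T₂`.**  For oval data and oval-shaped
representations `rI` (triangle at `P`, weight `x'`) and `rP` (oval carrier) there are: the largest root `e₁`
(`= -e₂-e₃`), the translated point `P + T₂ = (xQ, yQ)` on the identity component,
`xQ = e₂ + (e₂-e₁)(e₂-e₃)/(x_P-e₂)`, satisfying the FLOOR's torsion relation with `(N', a') = (2N, N-2a)`,
floor-shaped representations `rJ` (triangle at `xQ`) and `rQ` (floor carrier), and a log carrier `rC = [1<t<C, dt/t]`,
`C = √((e₂-e₃)/(e₂-x_P))`, with `[rI] − [rJ] + [rC] ∈ relations` (rule 2 by `φ₂ × φ₂`, rule 3 for the exact form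
`(φ₂(t') − t') dt'/y = −d(y/(2(t'−e₂)))`, Newton–Leibniz) and `[rP] − [rQ] ∈ relations` (rule 2 in each variable,
one Stokes step `φ₂(t)/√f = −(g₂t+2g₃)/(4t²√f) + d/dt[√f/(2t) − √f/(2(t−e₂))]`).
[cite: KontsevichZagier2001, §1.2 rules 1–3] [cite: Silverman2009, III.2.3 (addition formula)] -/
def OvalTransport : Prop := ∀ (g₂ g₃ e₂ e₃ xP yP : ℝ) (N a : ℕ) (f : ℝ → ℝ), (∀ x, f x = 4 * x ^ 3 - g₂ * x - g₃) → g₂ ^ 3 - 27 * g₃ ^ 2 ≠ 0 → f e₃ = 0 → f e₂ = 0 → e₃ < e₂ → (∀ x, e₃ < x → x < e₂ → 0 < f x) → e₃ < xP → xP < e₂ → yP ^ 2 = f xP → 3 ≤ N → 0 < a → 2 * a < N → (N : ℝ) * (∫ x in Set.Ioo e₃ xP, (Real.sqrt (f x))⁻¹) = a * (2 * ∫ x in Set.Ioo e₃ e₂, (Real.sqrt (f x))⁻¹) → ∀ (rI rP : Literature.NumberTheory.Transcendental.KZ.IntegralRep 2), rI.domain = {z | e₃ < z 1 ∧ z 1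 < z 0 ∧ z 0 < xP} → Set.EqOn rI.integrand (fun z => z 1 / (Real.sqrt (f (z 1)) * Real.sqrt (f (z 0)))) rI.domain → rP.domain = {z | e₃ < z 0 ∧ z 0 < e₂ ∧ e₃ < z 1 ∧ z 1 < e₂} → Set.EqOn rP.integrand (fun z => (Real.sqrt (f (z 0)))⁻¹ * (-(2 * z 1) / Real.sqrt (f (z 1)))) rP.domain → ∃ (e₁ xQ yQ C : ℝ) (rJ rQ : Literature.NumberTheory.Transcendental.KZ.IntegralRep 2) (rC : Literature.NumberTheory.Transcendental.KZ.IntegralRep 1), f e₁ = 0 ∧ 0 < e₁ ∧ (∀ x, e₁ < x → 0 < f x) ∧ e₁ < xQ ∧ yQ ^ 2 = f xQ ∧ xQ = e₂ + (e₂ - e₁) * (e₂ - e₃) / (xP - e₂) ∧ ((2 * N : ℕ) : ℝ) * (∫ x in Set.Ioi xQ, (Real.sqrt (f x))⁻¹) = ((N - 2 * a : ℕ) : ℝ) * (2 * ∫ x in Set.Ioi e₁, (Real.sqrt (f x))⁻¹) ∧ rJ.domain = {z | e₁ < z 1 ∧ z 1 < z 0 ∧ z 0 < xQ} ∧ Set.EqOn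 rJ.integrand (fun z => z 1 / (Real.sqrt (f (z 1)) * Real.sqrt (f (z 0)))) rJ.domain ∧ rQ.domain = {z | e₁ < z 0 ∧ e₁ < z 1} ∧ Set.EqOn rQ.integrand (fun z => (Real.sqrt (f (z 0)))⁻¹ * ((g₂ * z 1 + 2 * g₃) / (2 * (z 1) ^ 2 * Real.sqrt (f (z 1))))) rQ.domain ∧ 1 < C ∧ IsAlgebraic ℚ C ∧ rC.domain = {t | 1 < t 0 ∧ t 0 < C} ∧ Set.EqOn rC.integrand (fun t => (t 0)⁻¹) rC.domain ∧ Literature.NumberTheory.Transcendental.KZ.of rI - Literature.NumberTheory.Transcendental.KZ.of rJ + Literature.NumberTheory.Transcendental.KZ.of rC ∈ Literature.NumberTheory.Transcendental.KZ.relations ∧ Literature.NumberTheory.Transcendental.KZ.of rP - Literature.NumberTheory.Transcendental.KZ.of rQ ∈ Literature.NumberTheory.Transcendental.KZ.relations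

/-- **Stub 2 statement: the floor chain, free of the order hypothesis.**  `NeronTorsionPrimitiveChain` (the seed,
`stub_assembly`) VERBATIM with the hypothesis `∀ hns, addOrderOf (some xP (yP/2) hns) = N` deleted — the landed proof
binds it as `_hord` and never uses it (the torsion input it consumes is the analytic relation
`N · u(P) = a · ω₁`), so the same 40-line assembly proves this. [cite: KontsevichZagier2001, §1.2] -/
def IdentityChainFree : Prop := ∀ (g₂ g₃ e₁ xP yP : ℝ) (N a p q : ℕ) (f : ℝ → ℝ), (∀ x, f x = 4 * x ^ 3 - g₂ * x - g₃) → g₂ ^ 3 - 27 * g₃ ^ 2 ≠ 0 → f e₁ = 0 → 0 < e₁ → (∀ x, e₁ < x → 0 < f x) → e₁ < xP → yP ^ 2 = f xP → 3 ≤ N → 0 < a → 2 * a < N → (N : ℝ) * (∫ x in Set.Ioi xP, (Real.sqrt (f x))⁻¹) = a * (2 * ∫ x in Set.Ioi e₁, (Real.sqrt (f x))⁻¹) → Nat.Coprime p q → (q : ℤ) * ((N : ℤ) - 2 * (a : ℤ)) = (p : ℤ) * (2 * (N : ℤ)) → ∀ (rI rP : Literature.NumberTheory.Transcendental.KZ.IntegralRep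 2), rI.domain = {z | e₁ < z 1 ∧ z 1 < z 0 ∧ z 0 < xP} → Set.EqOn rI.integrand (fun z => z 1 / (Real.sqrt (f (z 1)) * Real.sqrt (f (z 0)))) rI.domain → rP.domain = {z | e₁ < z 0 ∧ e₁ < z 1} → Set.EqOn rP.integrand (fun z => (Real.sqrt (f (z 0)))⁻¹ * ((g₂ * z 1 + 2 * g₃) / (2 * (z 1) ^ 2 * Real.sqrt (f (z 1))))) rP.domain → ∃ (c : ℤ) (B : ℝ) (rB : Literature.NumberTheory.Transcendental.KZ.IntegralRep 1), 1 < B ∧ IsAlgebraic ℚ B ∧ rB.domain = {t | 1 < t 0 ∧ t 0 < B} ∧ Set.EqOn rB.integrand (fun t => (t 0)⁻¹) rB.domain ∧ ((q : ℤ) ^ 2) • Literature.NumberTheory.Transcendental.KZ.of rI + ((p : ℤ) ^ 2) • Literature.NumberTheory.Transcendental.KZ.of rP - c • Literature.NumberTheory.Transcendental.KZ.of rB ∈ Literature.NumberTheory.Transcendental.KZ.relations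

/-- The identity-component tied set `T` of the crux `TorsionSectorComplete` (copied verbatim). -/
def TorsionTied : Set Literature.NumberTheory.Transcendental.KZ.FormalRep := {d : Literature.NumberTheory.Transcendental.KZ.FormalRep | ∃ (g₂ g₃ e₁ xP yP α : ℝ) (N a : ℕ) (M k m : ℤ) (f : ℝ → ℝ) (rI rP : Literature.NumberTheory.Transcendental.KZ.IntegralRep 2) (rL : Literature.NumberTheory.Transcendental.KZ.IntegralRep 1), (∀ x, f x = 4 * x ^ 3 - g₂ * x - g₃) ∧ g₂ ^ 3 - 27 * g₃ ^ 2 ≠ 0 ∧ f e₁ = 0 ∧ 0 < e₁ ∧ (∀ x, e₁ < x → 0 < f x) ∧ e₁ < xP ∧ yP ^ 2 = f xP ∧ 3 ≤ N ∧ 0 < a ∧ 2 * a < N ∧ 4 * (N : ℤ) ^ 2 * k = M * ((N : ℤ) - 2 * (a : ℤ)) ^ 2 ∧ (∀ hns : (⟨0, 0, 0, -g₂ / 4, -g₃ / 4⟩ : WeierstrassCurve ℝ).toAffine.Nonsingular xP (yP / 2), addOrderOf (WeierstrassCurve.Affine.Point.some xP (yP / 2) hns) = N) ∧ (N : ℝ)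 * (∫ x in Set.Ioi xP, (Real.sqrt (f x))⁻¹) = a * (2 * ∫ x in Set.Ioi e₁, (Real.sqrt (f x))⁻¹) ∧ 1 < α ∧ rI.domain = {z | e₁ < z 1 ∧ z 1 < z 0 ∧ z 0 < xP} ∧ Set.EqOn rI.integrand (fun z => z 1 / (Real.sqrt (f (z 1)) * Real.sqrt (f (z 0)))) rI.domain ∧ rP.domain = {z | e₁ < z 0 ∧ e₁ < z 1} ∧ Set.EqOn rP.integrand (fun z => (Real.sqrt (f (z 0)))⁻¹ * ((g₂ * z 1 + 2 * g₃) / (2 * (z 1) ^ 2 * Real.sqrt (f (z 1))))) rP.domain ∧ rL.domain = {t | 1 < t 0 ∧ t 0 < α} ∧ Set.EqOn rL.integrand (fun t => (t 0)⁻¹) rL.domain ∧ (M : ℝ) * rI.value + k * rP.value = m * rL.value ∧ d = M • Literature.NumberTheory.Transcendental.KZ.of rI + k • Literature.NumberTheory.Transcendental.KZ.of rP - m • Literature.NumberTheory.Transcendental.KZ.of rL}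

/-- The oval tied set `T^{oval}` (the elements of the member `true`). -/
def OvalTied : Set Literature.NumberTheory.Transcendental.KZ.FormalRep := {d : Literature.NumberTheory.Transcendental.KZ.FormalRep | ∃ (g₂ g₃ e₂ e₃ xP yP α : ℝ) (N a : ℕ) (M k m : ℤ) (f : ℝ → ℝ) (rI rP : Literature.NumberTheory.Transcendental.KZ.IntegralRep 2) (rL : Literature.NumberTheory.Transcendental.KZ.IntegralRep 1), (∀ x, f x = 4 * x ^ 3 - g₂ * x - g₃) ∧ g₂ ^ 3 - 27 * g₃ ^ 2 ≠ 0 ∧ f e₃ = 0 ∧ f e₂ = 0 ∧ e₃ < e₂ ∧ (∀ x, e₃ < x → x < e₂ → 0 < f x) ∧ e₃ < xP ∧ xP < e₂ ∧ yP ^ 2 = f xP ∧ 3 ≤ N ∧ 0 < a ∧ 2 * a < N ∧ (N : ℤ) ^ 2 * k = M * (a : ℤ) ^ 2 ∧ (∀ hns : (⟨0, 0, 0, -g₂ / 4, -g₃ / 4⟩ : WeierstrassCurve ℝ).toAffine.Nonsingular xP (yP / 2), addOrderOf (WeierstrassCurve.Affine.Point.some xP (yP / 2) hns) = N) ∧ (N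 : ℝ) * (∫ x in Set.Ioo e₃ xP, (Real.sqrt (f x))⁻¹) = a * (2 * ∫ x in Set.Ioo e₃ e₂, (Real.sqrt (f x))⁻¹) ∧ 1 < α ∧ rI.domain = {z | e₃ < z 1 ∧ z 1 < z 0 ∧ z 0 < xP} ∧ Set.EqOn rI.integrand (fun z => z 1 / (Real.sqrt (f (z 1)) * Real.sqrt (f (z 0)))) rI.domain ∧ rP.domain = {z | e₃ < z 0 ∧ z 0 < e₂ ∧ e₃ < z 1 ∧ z 1 < e₂} ∧ Set.EqOn rP.integrand (fun z => (Real.sqrt (f (z 0)))⁻¹ * (-(2 * z 1) / Real.sqrt (f (z 1)))) rP.domain ∧ rL.domain = {t | 1 < t 0 ∧ t 0 < α} ∧ Set.EqOn rL.integrand (fun t => (t 0)⁻¹) rL.domain ∧ (M : ℝ) * rI.value + k * rP.value = m * rL.value ∧ d = M • Literature.NumberTheory.Transcendental.KZ.of rI + k • Literature.NumberTheory.Transcendental.KZ.of rP - m • Literature.NumberTheory.Transcendental.KZ.of rL}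

/-- **Stub 3 statement (residual, conjecture-grade): completeness off both real-component sectors.**  Two
rational-shape representations with equal values differ by an element of `relations ⊔ closure (T ∪ T^{oval})`.
Strictly between `KZKernelConjecture` (`relations` alone) and the crux (`relations ⊔ closure T`).
[cite: KontsevichZagier2001, §1.2 Conjecture 1] -/
def RealComponentsComplete : Prop := ∀ ⦃n m : ℕ⦄ (r : Literature.NumberTheory.Transcendental.KZ.IntegralRep n) (r' : Literature.NumberTheory.Transcendental.KZ.IntegralRep m), r.IsRational → r'.IsRational → r.value = r'.value → Literature.NumberTheory.Transcendental.KZ.of r - Literature.NumberTheory.Transcendental.KZ.of r' ∈ Literature.NumberTheory.Transcendental.KZ.relations ⊔ AddSubgroup.closure (TorsionTied ∪ OvalTied)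

/-! ### Registered stubs -/

/-- **Stub 1 (M–L, load-bearing).** `OvalTransport`. -/
theorem stub_ovalTransport : OvalTransport := by
  sorry

/-- **Stub 2 (M).** `IdentityChainFree` — the seed's statement minus its unused order hypothesis. -/
theorem stub_identityChainFree : IdentityChainFree := by
  sorry

/-- **Stub 3 (residual, conjecture-grade).** `RealComponentsComplete`. -/
theorem stub_realComponentsComplete : RealComponentsComplete := by
  sorry

/-! ### Proved infrastructure (no `sorry` below this line) -/

/-- The crux unfolds to completeness relative to `relations ⊔ closure T`. -/
theorem torsionSectorComplete_iff :
    Summit.KontsevichZagierPeriods.KontsevichZagierPeriods.Theses.TorsionLogs.TorsionSectorComplete ↔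
      ∀ ⦃n m : ℕ⦄ (r : Literature.NumberTheory.Transcendental.KZ.IntegralRep n)
        (r' : Literature.NumberTheory.Transcendental.KZ.IntegralRep m), r.IsRational → r'.IsRational →
        r.value = r'.value → Literature.NumberTheory.Transcendental.KZ.of r - Literature.NumberTheory.Transcendental.KZ.of r' ∈
          Literature.NumberTheory.Transcendental.KZ.relations ⊔ AddSubgroup.closure TorsionTied :=
  Iff.rfl

/-- Member `false` of the family is `NeronTorsionSector` on the nose. -/
theorem neronTorsionComponentSector_false_iff :
    NeronTorsionComponentSector false ↔
      Summit.KontsevichZagierPeriods.KontsevichZagierPeriods.Theses.TorsionLogs.NeronTorsionSector :=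
  Iff.rfl

/-- **Composition of stubs 1–2: the primitive oval chain.**  Transport to the identity component (stub 1), run the
floor chain at `P + T₂` with `(N', a') = (2N, N − 2a)` (stub 2; the reduced exponent `(N'−2a')/(2N') = a/N = p/q` is
the same), and fold the extra log carrier `q²•[rC]` into one log carrier (`exists_carrier_of_logFamily`, landed).
[cite: KontsevichZagier2001, §1.2] -/
theorem ovalPrimitiveChain_of (h₁ : OvalTransport) (h₂ : IdentityChainFree) : OvalPrimitiveChain := by
  intro g₂ g₃ e₂ e₃ xP yP N a p q f hf hdisc he₃ he₂ h32 hpos hx hx2 hy hN ha ha2 _hord htor hcop hρ rI rP hdI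
    hiI hdP hiP
  obtain ⟨e₁, xQ, yQ, C, rJ, rQ, rC, he₁, he₁0, hpos₁, hxQ, hyQ, _hxQdef, htorQ, hdJ, hiJ, hdQ, hiQ, hC, hCalg,
    hdC, hiC, hrelI, hrelP⟩ :=
    h₁ g₂ g₃ e₂ e₃ xP yP N a f hf hdisc he₃ he₂ h32 hpos hx hx2 hy hN ha ha2 htor rI rP hdI hiI hdP hiP
  have h2a : 2 * a ≤ N := by omega
  have hρ' : (q : ℤ) * ((((2 * N : ℕ)) : ℤ) - 2 * (((N - 2 * a : ℕ)) : ℤ)) = (p : ℤ) * (2 * (((2 * N : ℕ)) : ℤ)) := by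
    push_cast [Nat.cast_sub h2a]
    linear_combination (4 : ℤ) * hρ
  obtain ⟨c, B, rB, hB, hBalg, hdB, hiB, hchain⟩ :=
    h₂ g₂ g₃ e₁ xQ yQ (2 * N) (N - 2 * a) p q f hf hdisc he₁ he₁0 hpos₁ hxQ hyQ (by omega) (by omega) (by omega)
      htorQ hcop hρ' rJ rQ hdJ hiJ hdQ hiQ
  -- `X := q²•[rI] + p²•[rP]`;  `X − (c•[rB] − q²•[rC]) ∈ relations`
  have hX : ((q : ℤ) ^ 2) • KZ.of rI + ((p : ℤ) ^ 2) • KZ.of rP -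
      ∑ i : Fin 2, (![c, -((q : ℤ) ^ 2)] i) • KZ.of (![rB, rC] i) ∈ KZ.relations := by
    have e : ((q : ℤ) ^ 2) • KZ.of rI + ((p : ℤ) ^ 2) • KZ.of rP -
        ∑ i : Fin 2, (![c, -((q : ℤ) ^ 2)] i) • KZ.of (![rB, rC] i) =
        ((q : ℤ) ^ 2) • (KZ.of rI - KZ.of rJ + KZ.of rC) + ((p : ℤ) ^ 2) • (KZ.of rP - KZ.of rQ) +
          (((q : ℤ) ^ 2) • KZ.of rJ + ((p : ℤ) ^ 2) • KZ.of rQ - c • KZ.of rB) := by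
      simp only [Fin.sum_univ_two, Matrix.cons_val_zero, Matrix.cons_val_one, neg_smul]
      module
    rw [e]
    exact KZ.relations.add_mem (KZ.relations.add_mem (KZ.relations.zsmul_mem hrelI _)
      (KZ.relations.zsmul_mem hrelP _)) hchain
  exact exists_carrier_of_logFamily _ ![1, 1] ![B, C] ![c, -((q : ℤ) ^ 2)] ![rB, rC]
    (fun i => by fin_cases i <;> simp)
    (fun i => by fin_cases i <;> simp [hB.le, hC.le])
    (fun i => by fin_cases i <;> exact isAlgebraic_one)
    (fun i => by fin_cases i <;> simp [hBalg, hCalg])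
    (fun i => by fin_cases i <;> simp [hdB, hdC])
    (fun i => by
      fin_cases i
      · exact fun t ht => by simp [hiB ht]
      · exact fun t ht => by simp [hiC ht])
    hX

/-- **Bookkeeping (the landed `NeronTorsionSector_of_primitiveChain`, transported): the primitive oval chain gives
the tied oval sector** — reduced fraction `a/N = p/q`, tie `N²k = Ma²` ⇒ `(M, k) = s·(q², p²)`, soundness of the
calculus, Hermite–Lindemann for `log` of a real algebraic number, the landed interval-log calculus.
[cite: KontsevichZagier2001, §1.2] [cite: Lang1983, Ch. 13 Thm 1.1] -/
theorem ovalSector_of_ovalChain (hPC : OvalPrimitiveChain) : NeronTorsionComponentSector true := by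
  intro g₂ g₃ e₂ e₃ xP yP α N a M k m f hf hdisc he₃ he₂ h32 hpos hx hx2 hy hN ha ha2 htie hord htor hα rI rP rL
    hdI hiI hdP hiP hdL hiL hval
  -- reduced exponents `a/N = p/q`
  obtain ⟨p, q, hcop, hpqN, hq0⟩ : ∃ p q : ℕ, Nat.Coprime p q ∧ q * a = p * N ∧ 0 < q := by
    have hg0 : 0 < Nat.gcd a N := Nat.gcd_pos_of_pos_right _ (by omega)
    refine ⟨a / Nat.gcd a N, N / Nat.gcd a N, Nat.coprime_div_gcd_div_gcd hg0, ?_, ?_⟩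
    · have hp' : a / Nat.gcd a N * Nat.gcd a N = a := Nat.div_mul_cancel (Nat.gcd_dvd_left _ _)
      have hq' : N / Nat.gcd a N * Nat.gcd a N = N := Nat.div_mul_cancel (Nat.gcd_dvd_right _ _)
      calc N / Nat.gcd a N * a = N / Nat.gcd a N * (a / Nat.gcd a N * Nat.gcd a N) := by rw [hp']
        _ = a / Nat.gcd a N * (N / Nat.gcd a N * Nat.gcd a N) := by ring
        _ = a / Nat.gcd a N * N := by rw [hq']
    · exact Nat.div_pos (Nat.le_of_dvd (by omega) (Nat.gcd_dvd_right _ _)) hg0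
  have hpqZ : (q : ℤ) * (a : ℤ) = (p : ℤ) * (N : ℤ) := by exact_mod_cast hpqN
  -- the tie: `(M, k) = s • (q², p²)`
  have hN0 : (N : ℤ) ≠ 0 := by exact_mod_cast (show N ≠ 0 by omega)
  have hqk : (q : ℤ) ^ 2 * k = (p : ℤ) ^ 2 * M := by
    have h4 : (N : ℤ) ^ 2 ≠ 0 := pow_ne_zero 2 hN0
    apply mul_left_cancel₀ h4
    calc (N : ℤ) ^ 2 * ((q : ℤ) ^ 2 * k) = (q : ℤ) ^ 2 * ((N : ℤ) ^ 2 * k) := by ring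
      _ = (q : ℤ) ^ 2 * (M * (a : ℤ) ^ 2) := by rw [htie]
      _ = M * ((q : ℤ) * (a : ℤ)) ^ 2 := by ring
      _ = M * ((p : ℤ) * (N : ℤ)) ^ 2 := by rw [hpqZ]
      _ = (N : ℤ) ^ 2 * ((p : ℤ) ^ 2 * M) := by ring
  have hcopZ : IsCoprime ((q : ℤ) ^ 2) ((p : ℤ) ^ 2) := by
    have h := Nat.isCoprime_iff_coprime.mpr (hcop.symm.pow 2 2)
    push_cast at h
    exact h
  obtain ⟨s, hs⟩ : (q : ℤ) ^ 2 ∣ M :=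
    hcopZ.dvd_of_dvd_mul_left ⟨k, by linear_combination -hqk⟩
  have hq0Z : (q : ℤ) ^ 2 ≠ 0 := pow_ne_zero 2 (by exact_mod_cast hq0.ne')
  have hk : k = (p : ℤ) ^ 2 * s := by
    apply mul_left_cancel₀ hq0Z
    rw [hqk, hs]
    ring
  -- the primitive chain and its value
  obtain ⟨c, B, rB, hB, hBalg, hdB, hiB, hprim⟩ :=
    hPC g₂ g₃ e₂ e₃ xP yP N a p q f hf hdisc he₃ he₂ h32 hpos hx hx2 hy hN ha ha2 hord htor hcop hpqZ rI rP hdI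
      hiI hdP hiP
  have hvB : rB.value = Real.log B := logRep_value hB.le rB hdB hiB
  have hvL : rL.value = Real.log α := logRep_value hα.le rL hdL hiL
  have hαalg : IsAlgebraic ℚ α := isAlgebraic_of_logRep hα rL hdL
  have h0 : (q : ℝ) ^ 2 * rI.value + (p : ℝ) ^ 2 * rP.value - c * Real.log B = 0 := by
    have h := KZ.relations_le_ker_eval_holds hprim
    rw [AddMonoidHom.mem_ker] at h
    simpa only [map_add, map_sub, map_zsmul, KZ.eval_of, zsmul_eq_mul, Int.cast_pow, Int.cast_natCast,
      hvB] using h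
  -- the value hypothesis becomes a relation between two logarithms of algebraic numbers
  have hlog : (s : ℝ) * c * Real.log B - m * Real.log α = 0 := by
    have hM : (M : ℝ) = (q : ℝ) ^ 2 * s := by
      rw [hs]
      push_cast
      ring
    have hK : (k : ℝ) = (p : ℝ) ^ 2 * s := by
      rw [hk]
      push_cast
      ring
    rw [hM, hK, hvL] at hval
    linear_combination hval - (s : ℝ) * h0
  -- landed log calculus: `(s c)•[rB] − m•[rL] ∈ relations`
  have hiB1 : Set.EqOn rB.integrand (fun t : Fin 1 → ℝ => 1 / t 0) rB.domain := fun t ht => by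
    simp only [hiB ht, one_div]
  have hiL1 : Set.EqOn rL.integrand (fun t : Fin 1 → ℝ => 1 / t 0) rL.domain := fun t ht => by
    simp only [hiL ht, one_div]
  have hL : (s * c) • KZ.of rB - m • KZ.of rL ∈ KZ.relations := by
    have h := interval_log_relation_mem_relations 2 ![1, 1] ![B, α] ![s * c, -m] ![rB, rL]
      (fun i => by fin_cases i <;> simp)
      (fun i => by fin_cases i <;> simp [hB.le, hα.le])
      (fun i => by fin_cases i <;> exact isAlgebraic_one)
      (fun i => by fin_cases i <;> simp [hBalg, hαalg])
      (fun i => by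
        fin_cases i
        · exact ⟨hdB, hiB1⟩
        · exact ⟨hdL, hiL1⟩)
      (by
        simp only [Fin.sum_univ_two, Matrix.cons_val_zero, Matrix.cons_val_one, div_one, Int.cast_neg,
          Int.cast_mul]
        linear_combination hlog)
    have e : ∑ i : Fin 2, (![s * c, -m] i : ℤ) • KZ.of (![rB, rL] i) =
        (s * c) • KZ.of rB - m • KZ.of rL := by
      simp only [Fin.sum_univ_two, Matrix.cons_val_zero, Matrix.cons_val_one, neg_smul]
      abel
    rw [e] at h
    exact h
  -- assembly
  have e : M • KZ.of rI + k • KZ.of rP - m • KZ.of rL =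
      s • (((q : ℤ) ^ 2) • KZ.of rI + ((p : ℤ) ^ 2) • KZ.of rP - c • KZ.of rB) +
        ((s * c) • KZ.of rB - m • KZ.of rL) := by
    rw [hs, hk]
    module
  rw [e]
  exact KZ.relations.add_mem (KZ.relations.zsmul_mem hprim s) hL

/-- **F3 WITNESS — the floor is the member `false` of the family** (names the seed `stub_assembly`). -/
theorem neronTorsionComponentSector_false : NeronTorsionComponentSector false :=
  neronTorsionComponentSector_false_iff.mpr (NeronTorsionSector_of_primitiveChain stub_assembly)

/-- **The rung from stubs 1–2** (`<Rung>_of`): member `false` is the floor's chain (landed), member `true` is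
transport + floor chain at `P + T₂` + bookkeeping. [cite: KontsevichZagier2001, §1.2] -/
theorem neronTorsionRealComponents_of (h₁ : OvalTransport) (h₂ : IdentityChainFree) :
    NeronTorsionRealComponents := by
  intro b
  cases b
  · exact neronTorsionComponentSector_false
  · exact ovalSector_of_ovalChain (ovalPrimitiveChain_of h₁ h₂)

/-- The oval member says exactly `closure T^{oval} ≤ KZ.relations`. [cite: KontsevichZagier2001, §1.2] -/
theorem closure_ovalTied_le_relations (h : NeronTorsionComponentSector true) :
    AddSubgroup.closure OvalTied ≤ Literature.NumberTheory.Transcendental.KZ.relations := by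
  refine (AddSubgroup.closure_le _).mpr ?_
  rintro d ⟨g₂, g₃, e₂, e₃, xP, yP, α, N, a, M, k, m', f, rI, rP, rL, hf, hdisc, he₃, he₂, h32, hpos, hx, hx2, hy,
    hN, ha, ha', htie, hord, htor, hα, hdI, hiI, hdP, hiP, hdL, hiL, hval, rfl⟩
  exact h g₂ g₃ e₂ e₃ xP yP α N a M k m' f hf hdisc he₃ he₂ h32 hpos hx hx2 hy hN ha ha' htie hord htor hα rI rP
    rL hdI hiI hdP hiP hdL hiL hval

/-- The identity member says exactly `closure T ≤ KZ.relations`. [cite: KontsevichZagier2001, §1.2] -/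
theorem closure_torsionTied_le_relations (h : NeronTorsionComponentSector false) :
    AddSubgroup.closure TorsionTied ≤ Literature.NumberTheory.Transcendental.KZ.relations := by
  refine (AddSubgroup.closure_le _).mpr ?_
  rintro d ⟨g₂, g₃, e₁, xP, yP, α, N, a, M, k, m', f, rI, rP, rL, hf, hdisc, he, he0, hpos, hx, hy, hN, ha,
    ha', htie, hord, htor, hα, hdI, hiI, hdP, hiP, hdL, hiL, hval, rfl⟩
  exact h g₂ g₃ e₁ xP yP α N a M k m' f hf hdisc he he0 hpos hx hy hN ha ha' htie hord htor hα rI rP rL hdI hiI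
    hdP hiP hdL hiL hval

/-- **F4 ON-PATH LEMMA — the summit implies the rung** (Conjecture 1 in kernel form,
`kzKernelConjecture_iff_isRational`; a tied element of either member evaluates to `0` by its value hypothesis).
Tagged `@[simp]` so that the tribunal's forward probe `S → Rung` closes by `intro h; aesop`.
[cite: KontsevichZagier2001, §1.2] -/
@[simp] theorem neronTorsionRealComponents_of_kontsevichZagierPeriods (h : _root_.KontsevichZagierPeriods) :
    NeronTorsionRealComponents := by
  have hK : KZKernelConjecture := kzKernelConjecture_iff_isRational.mpr h
  intro b
  cases b
  · intro g₂ g₃ e₁ xP yP α N a M k m f _ _ _ _ _ _ _ _ _ _ _ _ _ _ rI rP rL _ _ _ _ _ _ hval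
    apply hK
    rw [map_sub, map_add, map_zsmul, map_zsmul, map_zsmul, KZ.eval_of, KZ.eval_of, KZ.eval_of, zsmul_eq_mul,
      zsmul_eq_mul, zsmul_eq_mul]
    linarith [hval]
  · intro g₂ g₃ e₂ e₃ xP yP α N a M k m f _ _ _ _ _ _ _ _ _ _ _ _ _ _ _ _ rI rP rL _ _ _ _ _ _ hval
    apply hK
    rw [map_sub, map_add, map_zsmul, map_zsmul, map_zsmul, KZ.eval_of, KZ.eval_of, KZ.eval_of, zsmul_eq_mul,
      zsmul_eq_mul, zsmul_eq_mul]
    linarith [hval]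

/-- The residual is a consequence of the crux (hence of the summit): `closure T ≤ closure (T ∪ T^{oval})`.
(Informational: stub 3 is WEAKER than the crux as typed.) [folklore] -/
theorem realComponentsComplete_of_torsionSectorComplete
    (h : Summit.KontsevichZagierPeriods.KontsevichZagierPeriods.Theses.TorsionLogs.TorsionSectorComplete) :
    RealComponentsComplete := by
  intro n m r r' hr hr' hv
  have hmono : Literature.NumberTheory.Transcendental.KZ.relations ⊔ AddSubgroup.closure TorsionTied ≤
      Literature.NumberTheory.Transcendental.KZ.relations ⊔ AddSubgroup.closure (TorsionTied ∪ OvalTied) :=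
    sup_le_sup_left (AddSubgroup.closure_mono Set.subset_union_left) _
  exact hmono (torsionSectorComplete_iff.mp h r r' hr hr' hv)

/-! ### Composition: the crux BY NAME from the three stubs -/

/-- **`TorsionSectorComplete` from the stubs** (closed term; `sorry` only through `stub_ovalTransport`,
`stub_identityChainFree`, `stub_realComponentsComplete`): the rung (stubs 1–2) folds the oval sector into the moves
(`closure T^{oval} ≤ relations`), so the residual's `relations ⊔ closure (T ∪ T^{oval})` is
`≤ relations ⊔ closure T`. [cite: KontsevichZagier2001, §1.2] -/
theorem TorsionSectorComplete_of :
    Summit.KontsevichZagierPeriods.KontsevichZagierPeriods.Theses.TorsionLogs.TorsionSectorComplete := by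
  suffices key : OvalTransport → IdentityChainFree → RealComponentsComplete →
      Summit.KontsevichZagierPeriods.KontsevichZagierPeriods.Theses.TorsionLogs.TorsionSectorComplete from
    key stub_ovalTransport stub_identityChainFree stub_realComponentsComplete
  intro h₁ h₂ h₃
  rw [torsionSectorComplete_iff]
  intro n m r r' hr hr' hv
  have hR : NeronTorsionRealComponents := neronTorsionRealComponents_of h₁ h₂
  have hle : Literature.NumberTheory.Transcendental.KZ.relations ⊔ AddSubgroup.closure (TorsionTied ∪ OvalTied) ≤
      Literature.NumberTheory.Transcendental.KZ.relations ⊔ AddSubgroup.closure TorsionTied := by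
    refine sup_le le_sup_left ((AddSubgroup.closure_le _).mpr ?_)
    rintro d (hd | hd)
    · exact AddSubgroup.mem_sup_right (AddSubgroup.subset_closure hd)
    · exact AddSubgroup.mem_sup_left (closure_ovalTied_le_relations (hR true) (AddSubgroup.subset_closure hd))
  exact hle (h₃ r r' hr hr' hv)

end Summit.KontsevichZagierPeriods.KontsevichZagierPeriods.Cruxes.TorsionSectorComplete.NeronTorsionOval

end
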